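import Literature.AlgebraicGeometry.AbelianSchemes.AbelianSchemeQuotientPolarizationIdentity
import Literature.AlgebraicGeometry.AbelianSchemes.DualIsogenyMulN
import Literature.AlgebraicGeometry.AbelianSchemes.AbelianSchemeDualIsogenyComp
import Literature.AlgebraicGeometry.AbelianSchemes.AbelianSchemeDualIsogenyHom
import HarnessLib

/-!
# `[n] ≫ (π_d ≫ λ ≫ π_d^∨) = λ_B ≫ [d²]` — the polarisation of the isogeny quotient read back along the descended multiplication
# `π_d : A/K → A` (export (b′) of the Hecke-link line; [MumfordAV1970] §23 p. 231, §15 Thm. 1; [MilneAV2008] I §8–§9)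

Topic `AlgebraicGeometry/AbelianSchemes`; namespace `Literature.AlgebraicGeometry.AbelianSchemes.AbelianSchemeOver`.
KERNEL ONLY: theorems; no definition, no named fact, no instance, no `sorry`.

Cell hodgecm-mathlib, Hecke-link line, socket (B) / (X-amp-2) input (B-p20 (g9) 22:41:18Z «(b′) is B-p14's»): for the quotient
`ψ : A → B := A/K` (`K` killed by `n` and by `d`), the descended maps `π_n, π_d : B → A` (★ `mulNDesc`, `ψ ≫ π_m = [m]_A`,
`π_m ≫ ψ = [m]_B`), the descended polarisation `λ_B` (★ `polarizationDesc`) and the dual pair `DB` of `B` built with `π_n`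
(★ `dualPairOfQuotientRigidified`), the pull-back of `λ` along `π_d` satisfies, in the HONEST MULTIPLIED FORM (no division by `n`):
`[n]_B ≫ (π_d ≫ λ ≫ π_d^∨) = λ_B ≫ [d²]_{B̂}` — from export (b) `ψ ≫ λ_B ≫ ψ^∨ = λ ≫ [n]` (★ B-p20
`comp_polarizationDesc_comp_dualIsogenyOver_of_dualIsogeny_mulN` + ★ `dualIsogenyOver_mulN` / ★ B-p14 p748776), ★ `dualIsogenyOver_comp`, ★ `dualIsogenyOver_mulN`
(for `DB`, under its unit hypothesis `hDB`), and the commutation of homomorphisms with `[m]`.  In the Hecke instance `n = ν`,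
`d = N′/N`, so `π_d ≫ λ′ ≫ π_d^∨` is «`(d²/ν)·λ_B`» once `[ν]` is cancelled ((X-amp-2)/(X-amp-3) consume the multiplied form).

* `mulN_comp_of_isMonHom` — `[m]_M ≫ g = g ≫ [m]_N` for a homomorphism `g` (Mathlib `MonObj.pow_comp`/`comp_pow`).
* `mulN_comp_mulN` — `[a] ≫ [b] = [a·b]`.
* `mulN_comp_mulNDesc_comp_comp_dualIsogenyOver` — the identity (b′), multiplied form with `[n]` on the LEFT (the form with
  `[n]` on the right follows since `π_d ≫ λ ≫ π_d^∨` is a homomorphism: ★ `isMonHom_dualIsogenyOver` under `hDB`, `hD`, and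
  `mulN_comp_of_isMonHom`).

## References
* [MumfordAV1970] §23 (p. 231), §15 Thm. 1 (p. 143), §7 Thm. 4 (p. 72).  * [MilneAV2008] I §8 pp. 36–37, §9 Thm. 9.1 (p. 42).
HC_CM is proved only modulo the 7 printed citations until rung 0 closes; this file discharges none of them.
-/

set_option autoImplicit false

noncomputable section

universe u

open CategoryTheory CategoryTheory.Limits AlgebraicGeometry MonoidalCategory CartesianMonoidalCategory
open scoped MonObj

namespace Literature.AlgebraicGeometry.AbelianSchemes

namespace AbelianSchemeOver

/-! ### §0 `[m]` commutes with homomorphisms; `[a] ≫ [b] = [ab]` -/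

/-- **A homomorphism commutes with multiplication by `m`**: `[m]_M ≫ g = g ≫ [m]_N`. [cite: MumfordFogartyKirwan1994, Ch. 6 §1 (p. 115)] -/
theorem mulN_comp_of_isMonHom {S : Scheme.{u}} {M N : AbelianSchemeOver S} (g : M.X ⟶ N.X) [IsMonHom g] (m : ℕ) :
    M.mulN m ≫ g = g ≫ N.mulN m := by
  rw [mulN_def, mulN_def, MonObj.pow_comp, MonObj.comp_pow, Category.id_comp, Category.comp_id]

/-- **`[a] ≫ [b] = [a·b]`.** [cite: MumfordFogartyKirwan1994, Ch. 6 §1 (p. 115)] -/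
theorem mulN_comp_mulN {S : Scheme.{u}} (M : AbelianSchemeOver S) (a b : ℕ) : M.mulN a ≫ M.mulN b = M.mulN (a * b) := by
  rw [mulN_def, mulN_def, mulN_def, MonObj.comp_pow, Category.comp_id, ← pow_mul]

variable {S : Scheme.{u}} [IsReduced S] [IsLocallyNoetherian S] (A : AbelianSchemeOver S)
  {Y : Scheme.{u}} (u : S ⟶ Y) (K : Subgroup A.Sections) [IsCommMonObj A.X] {n : ℕ}
  (hK : ∀ σ : K, (σ : A.Sections) ^ n = 1)
  [Finite K] [Y.IsSeparated] [IsSeparated (A.X.hom ≫ u)] [S.IsSeparated]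
  (hcov : ∀ x : A.left, ∃ O : (A.translationActionOver u K).StableAffineOpens, x ∈ O.1)
  [LocallyOfFiniteType (A.X.hom ≫ u)] [IsLocallyNoetherian Y]
  (hG : ∃ _ : GrpObj (A.quotientOver u K), IsMonHom (A.quotientMk u K hcov))
  (hsm : Smooth (A.quotientOver u K).hom) (hgc : GeometricallyConnected (A.quotientOver u K).hom)
  (D : A.DualPair) [IsAffine Y]
  (hfree : ∀ (Ω : Type u) [Field Ω] [IsAlgClosed Ω] (x : Spec (.of Ω) ⟶ A.left) (σ : K), σ ≠ 1 →
    x ≫ (A.translation (σ : A.Sections)).left ≠ x)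
  (K' : Subgroup D.hat.Sections) [Finite K'] [IsSeparated (D.hat.X.hom ≫ u)]
  (hcov' : ∀ x : D.hat.left, ∃ O : (D.hat.translationActionOver u K').StableAffineOpens, x ∈ O.1)
  [LocallyOfFiniteType (D.hat.X.hom ≫ u)]
  (hG' : ∃ _ : GrpObj (D.hat.quotientOver u K'), IsMonHom (D.hat.quotientMk u K' hcov'))
  (hsm' : Smooth (D.hat.quotientOver u K').hom) (hgc' : GeometricallyConnected (D.hat.quotientOver u K').hom)
  (hfree' : ∀ (Ω : Type u) [Field Ω] [IsAlgClosed Ω] (x : Spec (.of Ω) ⟶ D.hat.left) (σ : K'), σ ≠ 1 →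
    x ≫ (D.hat.translation (σ : D.hat.Sections)).left ≠ x)
  (Φ : (prodTranslationActionOver (A.quotientBy u K hcov hG hsm hgc) D.hat u K' hcov').EquivariantStructure
    (A.poincarePullback u K hK hcov hG hsm hgc D hfree))
  (lam : A.X ⟶ D.hat.X) [IsMonHom lam]
  (hlam : ∀ σ : K, A.translation (σ : A.Sections) ≫ lam ≫ D.hat.quotientMk u K' hcov' = lam ≫ D.hat.quotientMk u K' hcov')

/-! ### §1 The identity (b′), multiplied form -/

/-- **`[n]_B ≫ (π_d ≫ λ ≫ π_d^∨) = λ_B ≫ [d²]_{B̂}`** (module docstring).  Hypotheses beyond the quotient data: the unit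
hypotheses `hD` (for `A`, e.g. ★ `Polarization.nonempty_unitHatSlice_iso`) and `hDB` (for the quotient's dual pair — from any
family of `Λ(𝒪(·))`-witnesses of any homomorphism `B → B̂`, ★ `nonempty_unitHatSlice_iso_of_forall_isLambdaOfAt`), and
`hKd : K ⊆ A[d]`. [cite: MumfordAV1970, §23 (p. 231)] [cite: MilneAV2008, I §9 Thm. 9.1 (p. 42)] -/
theorem mulN_comp_mulNDesc_comp_comp_dualIsogenyOver (h4)
    (hD : Nonempty ((Scheme.Modules.pullback (DualPair.unitHatSlice D)).obj D.P ≅ SheafOfModules.unit _))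
    (hDB : Nonempty ((Scheme.Modules.pullback (DualPair.unitHatSlice
      (A.dualPairOfQuotientRigidified u K hK hcov hG hsm hgc D hfree K' hcov' hG' hsm' hgc' hfree' Φ h4))).obj
      (A.dualPairOfQuotientRigidified u K hK hcov hG hsm hgc D hfree K' hcov' hG' hsm' hgc' hfree' Φ h4).P ≅
        SheafOfModules.unit _))
    {d : ℕ} (hKd : ∀ σ : K, (σ : A.Sections) ^ d = 1) :
    letI : GrpObj (A.quotientOver u K) := (A.quotientBy u K hcov hG hsm hgc).grpObj
    letI : GrpObj (D.hat.quotientOver u K') := (D.hat.quotientBy u K' hcov' hG' hsm' hgc').grpObj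
    haveI := A.isMonHom_mulNDesc u K hKd hcov hG hsm hgc hfree
    (A.quotientBy u K hcov hG hsm hgc).mulN n ≫
        (A.mulNDesc u K hKd hcov : (A.quotientBy u K hcov hG hsm hgc).X ⟶ A.X) ≫ lam ≫
          @DualPair.dualIsogenyOver S (A.quotientBy u K hcov hG hsm hgc) A (A.mulNDesc u K hKd hcov)
            (A.isMonHom_mulNDesc u K hKd hcov hG hsm hgc hfree)
            (A.dualPairOfQuotientRigidified u K hK hcov hG hsm hgc D hfree K' hcov' hG' hsm' hgc' hfree' Φ h4) D =
      A.polarizationDesc u K hcov D.hat K' hcov' lam hlam ≫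
        (D.hat.quotientBy u K' hcov' hG' hsm' hgc').mulN (d * d) := by
  letI : GrpObj (A.quotientOver u K) := (A.quotientBy u K hcov hG hsm hgc).grpObj
  letI : GrpObj (D.hat.quotientOver u K') := (D.hat.quotientBy u K' hcov' hG' hsm' hgc').grpObj
  haveI hψ := A.isMonHom_quotientMk u K hcov hG hsm hgc
  haveI hπ := A.isMonHom_mulNDesc u K hKd hcov hG hsm hgc hfree
  haveI := A.isMonHom_mulN n
  haveI : IsCommMonObj (A.quotientBy u K hcov hG hsm hgc).X := (A.quotientBy u K hcov hG hsm hgc).isCommMonObj_of_isReduced_base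
  haveI hBd := (A.quotientBy u K hcov hG hsm hgc).isMonHom_mulN d
  haveI hlamB := A.isMonHom_polarizationDesc u K hcov hG hsm hgc hfree D.hat K' hcov' hG' hsm' hgc' lam hlam
  -- export (b): `ψ ≫ λ_B ≫ ψ^∨ = λ ≫ [n]`
  have hb := A.comp_polarizationDesc_comp_dualIsogenyOver_of_dualIsogeny_mulN u K hK hcov hG hsm hgc D hfree K' hcov' hG' hsm'
    hgc' hfree' Φ lam hlam h4 (D.dualIsogenyOver_mulN hD n)
  -- `ψ ≫ π_d = [d]_A`, `π_d ≫ ψ = [d]_B`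
  have hψπ := A.quotientMk_comp_mulNDesc u K hKd hcov
  have hπψ := A.mulNDesc_comp_quotientMk u K hKd hcov hG hsm hgc hfree
  -- `ψ^∨ ≫ π_d^∨ = (π_d ≫ ψ)^∨ = [d]^∨ = [d]_{B̂}`
  have hdual :
      @DualPair.dualIsogenyOver S A (A.quotientBy u K hcov hG hsm hgc) (A.quotientMk u K hcov) hψ D
          (A.dualPairOfQuotientRigidified u K hK hcov hG hsm hgc D hfree K' hcov' hG' hsm' hgc' hfree' Φ h4) ≫
        @DualPair.dualIsogenyOver S (A.quotientBy u K hcov hG hsm hgc) A (A.mulNDesc u K hKd hcov) hπ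
          (A.dualPairOfQuotientRigidified u K hK hcov hG hsm hgc D hfree K' hcov' hG' hsm' hgc' hfree' Φ h4) D =
      (D.hat.quotientBy u K' hcov' hG' hsm' hgc').mulN d := by
    have h1 := (@DualPair.dualIsogenyOver_comp S (A.quotientBy u K hcov hG hsm hgc) A (A.quotientBy u K hcov hG hsm hgc)
      (A.mulNDesc u K hKd hcov) (A.quotientMk u K hcov) hπ hψ
      (A.dualPairOfQuotientRigidified u K hK hcov hG hsm hgc D hfree K' hcov' hG' hsm' hgc' hfree' Φ h4) D
      (A.dualPairOfQuotientRigidified u K hK hcov hG hsm hgc D hfree K' hcov' hG' hsm' hgc' hfree' Φ h4)).symm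
    refine h1.trans ?_
    refine (DualPair.dualIsogenyOver_congr (h₂ := hBd) _ _ hπψ).trans ?_
    exact DualPair.dualIsogenyOver_mulN _ hDB d
  -- `[n]_A ≫ λ = λ ≫ [n]_Â`, `[n]_B ≫ π_d = π_d ≫ [n]_A`, `[d]_B ≫ λ_B = λ_B ≫ [d]`
  have hlamN : A.mulN n ≫ lam = lam ≫ D.hat.mulN n := mulN_comp_of_isMonHom lam n
  have hπN : (A.quotientBy u K hcov hG hsm hgc).mulN n ≫ A.mulNDesc u K hKd hcov = A.mulNDesc u K hKd hcov ≫ A.mulN n :=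
    @mulN_comp_of_isMonHom S (A.quotientBy u K hcov hG hsm hgc) A (A.mulNDesc u K hKd hcov) hπ n
  have hlamBd : (A.quotientBy u K hcov hG hsm hgc).mulN d ≫ A.polarizationDesc u K hcov D.hat K' hcov' lam hlam =
      A.polarizationDesc u K hcov D.hat K' hcov' lam hlam ≫ (D.hat.quotientBy u K' hcov' hG' hsm' hgc').mulN d :=
    @mulN_comp_of_isMonHom S (A.quotientBy u K hcov hG hsm hgc) (D.hat.quotientBy u K' hcov' hG' hsm' hgc')
      (A.polarizationDesc u K hcov D.hat K' hcov' lam hlam) hlamB d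
  -- assemble with explicit whiskering (no `rw`: the quotient's two spellings defeat keyed rewriting)
  -- abbreviations (terms only)
  have e1 := eq_whisker hπN (lam ≫ @DualPair.dualIsogenyOver S (A.quotientBy u K hcov hG hsm hgc) A (A.mulNDesc u K hKd hcov)
    hπ (A.dualPairOfQuotientRigidified u K hK hcov hG hsm hgc D hfree K' hcov' hG' hsm' hgc' hfree' Φ h4) D)
  -- `e1 : ([n] ≫ π_d) ≫ lam ≫ π_d^∨ = (π_d ≫ [n]) ≫ lam ≫ π_d^∨`
  refine ((Category.assoc _ _ _).symm.trans (e1.trans ((Category.assoc _ _ _).trans ?_)))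
  -- goal: `π_d ≫ [n] ≫ lam ≫ π_d^∨ = λ_B ≫ [d²]`
  have e2 : A.mulN n ≫ lam ≫ @DualPair.dualIsogenyOver S (A.quotientBy u K hcov hG hsm hgc) A (A.mulNDesc u K hKd hcov)
        hπ (A.dualPairOfQuotientRigidified u K hK hcov hG hsm hgc D hfree K' hcov' hG' hsm' hgc' hfree' Φ h4) D =
      (A.quotientMk u K hcov ≫ A.polarizationDesc u K hcov D.hat K' hcov' lam hlam ≫
        @DualPair.dualIsogenyOver S A (A.quotientBy u K hcov hG hsm hgc) (A.quotientMk u K hcov) hψ D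
          (A.dualPairOfQuotientRigidified u K hK hcov hG hsm hgc D hfree K' hcov' hG' hsm' hgc' hfree' Φ h4)) ≫
      @DualPair.dualIsogenyOver S (A.quotientBy u K hcov hG hsm hgc) A (A.mulNDesc u K hKd hcov)
        hπ (A.dualPairOfQuotientRigidified u K hK hcov hG hsm hgc D hfree K' hcov' hG' hsm' hgc' hfree' Φ h4) D :=
    ((Category.assoc _ _ _).symm.trans (eq_whisker hlamN _)).trans (eq_whisker hb.symm _)
  refine (whisker_eq (A.mulNDesc u K hKd hcov) e2).trans ?_
  -- goal: `π_d ≫ (ψ ≫ λ_B ≫ ψ^∨) ≫ π_d^∨ = λ_B ≫ [d²]`; reassociate to `(π_d ≫ ψ) ≫ λ_B ≫ (ψ^∨ ≫ π_d^∨)`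
  refine ((whisker_eq (A.mulNDesc u K hKd hcov)
    ((Category.assoc (A.quotientMk u K hcov) _ _).trans (whisker_eq (A.quotientMk u K hcov) (Category.assoc _ _ _)))).trans
    (Category.assoc (A.mulNDesc u K hKd hcov) (A.quotientMk u K hcov) _).symm).trans ?_
  -- substitute `π_d ≫ ψ = [d]` and `ψ^∨ ≫ π_d^∨ = [d]`
  refine ((eq_whisker hπψ _).trans (whisker_eq _ (whisker_eq _ hdual))).trans ?_
  -- `[d] ≫ λ_B ≫ [d] = λ_B ≫ [d] ≫ [d] = λ_B ≫ [d²]`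
  exact ((Category.assoc _ _ _).symm.trans ((eq_whisker hlamBd _).trans (Category.assoc _ _ _))).trans
    (whisker_eq _ (mulN_comp_mulN _ d d))


end AbelianSchemeOver

end Literature.AlgebraicGeometry.AbelianSchemes

end
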